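import Literature.MathematicalPhysics.QuantumFieldTheory.Balaban1983to89.B9Cor35GpCubeInputsAtOne
import Literature.MathematicalPhysics.QuantumFieldTheory.Balaban1983to89.B9Thm34SectBUniformR1

/-!
# `Balaban1983to89.B9Cor35GpAtCubeLetters` — [Balaban1985BackgroundPropagators] COROLLARY 3.5 p. 407 FOR THE CUBE LETTER `G′_□` OF SECT. C p. 409:
# THEOREM 3.4's CONCLUSION (existence of `G′_□(U′·1) = (Δ′_{a,□}(U′·1))⁻¹` and the transfer of every (3.42)-type entry) AT `U = 1` OVER THE CUBE
# SEQUENCE `{Ω_n(□)}`, UNIFORMLY IN THE MEMBER AND THE COVER CUBE — Sect. B's engine `B9Thm34SectBUniformR1.thm34_Gp_uniform` with EVERY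
# `A`-INDEPENDENT BINDER DISCHARGED (FILES 5a, 5b and M5.1a's Theorem 3.1) — sub-row G-B9-LETTERS, module M5.1b-G′ (site sector), FILE 6 of seat p33's plan

statement-level skeleton of published theorems with citation tags; proofs where landed; nothing here is a claim about the Yang–Mills mass gap

CITATION HEADER (lean-in-tree rule).  B9 = T. Bałaban, *Propagators for lattice gauge theories in a background field*, Commun. Math. Phys. **99** (1985)
389–434 [Balaban1985BackgroundPropagators] (held `paper:balaban1985-cmp99-background-propagators`; journal page = PDF page + 388): Cor. 3.5 p. 407 l. 26–31
«The theorems hold also for the operators (3.24), (3.25) … for U′ satisfying (3.37) with the same vector potentials and with U = 1, these theorems were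
proved in [4]»; p. 409 l. 1–5 «the sequence {Ω_n(□)} satisfies the assumptions of Corollary 3.6. The operators constructed for this sequence … satisfy
all the inequalities of Theorems 3.1–3.3»; Thm 3.4 p. 400; p. 399 l. 1–3 (constants depend on `d, L` and the bounds (2.1)–(2.2) only); p. 402
(3.60)–(3.65), «for α₁ sufficiently small»; p. 403 «of course with different constants»; Thm 3.1 (3.42) p. 397.  [4] = [Balaban1984PropagatorsII]
Prop. 2.2 (2.67) p. 234, Lemma 2.1 (2.59)–(2.61) pp. 233–234.  Rows B9.Cor3.5 × B9.Thm3.4 (cells only; no row head changes).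

WHY THIS FILE (cell lit-balaban, sub-row G-B9-LETTERS, module M5.1b-G′ booked to seat p33 g96; memo `lit-balaban-p33/COR35GP-STATEMENTS-p33.md`).  The
cube road of Cor. 3.6 (design (R): double cut-off, FILES 2–4) needs, per cover cube `□` and (3.35) datum `(u, A)`, the invertibility of `Δ′_{a,□}(Ṽ_□)`
(`Ṽ_□ = e^{iηχ̃_□A}·1`) and Theorem 3.1's (3.42) entries for `G′_□(Ṽ_□)` — Corollary 3.5: Theorem 3.4 for the cube letters at `U = 1` with the
(3.37)-small `U′`.  Sect. B's engine `thm34_Gp_uniform` (r06, lattice-free `a₁`, `B`) delivers exactly this once its binders are supplied at the cube: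
the geometry and its axioms, [4] (2.61) and the p. 398 transfers (FILE 5a, `geoCK i □`), the stencil, the letters `Δp, Gp` with their laws and the
(3.19)/(3.24) sizes (FILE 5b), and Theorem 3.1 (3.42)₁₋₃ for `Gp = conj b(η²G′_□(1))` for all `k : κ ⊕ κ` — M5.1a's three printed orientations
(`B9Thm31CubeLocalFlat.thm31_cubeW_flat_first/second/third`) plus FILE 5b's two shift-derived ones, merged here at ONE rate (§1).  §2 is the application.

WHAT IS PROVED (0 `def`; 0 sorry; 0 new named facts; standard axioms):
* §1 `hasMajorant_weaken` (`B9FromB6.decay_mono`), ★★★`thm31_cube_allOrientations` — `∃ δ₁ C₁ M₀ T₀ N₀` (functions of `d, L`) with, for every member above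
  `M₀ ≤ L·M_h`, `N₀ + 1 ≤ R·L·M_h`, `T₀ ≤ R·L·M_h − 1`, every cover cube and every `Rr, H`: the five scalar block majorants over `toB6 (geoCK i □) Rr H` —
  `GpCubeW ≺ C₁L^{2n}e^{−δ₁d}`, `∂_μ·GpCubeW`, `GpCubeW·∂_μᵀ`, `∂_μᵀ·GpCubeW`, `GpCubeW·∂_μ ≺ C₁Lⁿe^{−δ₁d}` (rate `δ₁ = min/8`, the shift entries via
  FILE 5b §5 with FILE 5a's `exists_h261_geoCK` at two rate pairs and `hST_geoCK` at `(δ, 1/2)`);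
* §2 `hasMajorant_geomT_of_toB6`, ★★★`cor35_Gp_cube` — `∃ δ₀ BG M₀ T₀ N₀, 0 < δ₀ ∧ 0 < BG ∧ ∃ a₁ > 0, ∃ B ≥ 0, ∀ i □ Rr H par (par 1 = 1), thresholds →
  ∀ α₁ ∈ [0, a₁] ∀ A kF sF` with (3.59) sizes `C_q·α₁·w`, `C_q·α₁` and the five blockwise (3.37) bounds over the cube blocks (`T := shiftY i`, `U := 1`,
  `η := (geoCK i □).eta = |c_f|⁻¹`): the four conclusions of `thm34_Gp_uniform` VERBATIM at `Δp := DpK b i □ par`, `Gp := GpK b i □ par`,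
  `blk := blkCubeY i □`, `kQ := kQCubeY i □ par 1`, `sQ := sQCubeY i □ par 1`, `cfun := cfunK i □`, `w := wK i □`, `Λ(α) := L⁴`, `a₀ := 1`, `d₀ := 1`.

PROOF.  Ours; assembly.  `thm34_Gp_uniform` is invoked ONCE with `d := dB` (FILE 5a's door exponent at `δ₁`), `δ₀ := δ₁`, `BG := C₁`; its `∃ a₁ B`
precede the lattice, so `a₁, B` depend on `d, L, M₂, C_q` only (p. 399 l. 1–3).

HONEST SCOPE / NOT CLAIMED.  `U = 1` at the cube (Cor. 3.5's case); the `A`-dependent binders (`kF`, `sF` sizes, the five (3.37) readings) remain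
hypotheses here — FILE 4's `readings337_locFld` and `B9Eq359CubeKernelsAtOne` supply them for `A := χ̃_□·A` (FILE 7a); the member thresholds and the
transporter clause `par 1 = 1` are displayed; `‖1‖ ≤ 1` is assumed; the (3.43)/(3.46)–(3.47) entries are not part of this engine; nothing on `d = 4`,
the continuum, reflection positivity or the mass gap; NOT a node discharge; no row head changes.

RELATED IN THE TREE, NOT DUPLICATED: n06-c's member chain `B9SectBV2Step.stepBound_V2_proved` ∕ `B9SectBGpFrameCodedY` (the same engine at the MEMBER's
letters, with the reading/writing dictionaries as named hypotheses); r05's `B9Thm31CubeLocalFlatMember(Global)` (Theorem 3.1 for `G′_□(1)` in the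
member's blocks — downstream coarsening, not used here).
-/

noncomputable section

namespace Literature.MathematicalPhysics.QuantumFieldTheory.Balaban1983to89.B9Cor35GpAtCubeLetters

open Literature.MathematicalPhysics.QuantumFieldTheory.Balaban1983to89
open Literature.MathematicalPhysics.QuantumFieldTheory.Balaban1983to89.B6RandomWalk (HasMajorant BlockSupp hasMajorant_mono Triangle254 Ineq261 c1_nonneg)
open Literature.MathematicalPhysics.QuantumFieldTheory.Balaban1983to89.B9Thm34Ext (toB6)
open Literature.MathematicalPhysics.QuantumFieldTheory.Balaban1983to89.B9Ineq347 (ScaleTransfer)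
open Literature.MathematicalPhysics.QuantumFieldTheory.Balaban1983to89.B9Eq352DivFormLetters (conj)
open Literature.MathematicalPhysics.QuantumFieldTheory.Balaban1983to89.B9Eq352GradLetters (diffLetter)
open Literature.MathematicalPhysics.QuantumFieldTheory.Balaban1983to89.B9Eq360Vprime (gPrimeExtEnd)
open Literature.MathematicalPhysics.QuantumFieldTheory.Balaban1983to89.B9Eq360VprimeLetters (vPrimeConc)
open Literature.MathematicalPhysics.QuantumFieldTheory.Balaban1983to89.B9Eq39Adjoint (covD covDstar)
open Literature.MathematicalPhysics.QuantumFieldTheory.Balaban1983to89.B9Eq352DivForm (tauB)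
open Literature.MathematicalPhysics.QuantumFieldTheory.Balaban1983to89.B9Thm34SectBUniformR1 (thm34_Gp_uniform)
open Literature.MathematicalPhysics.QuantumFieldTheory.Balaban1983to89.B6KLevelCensusIndexV1 (KIdx kGeo)
open Literature.MathematicalPhysics.QuantumFieldTheory.Balaban1983to89.B6Cover236MultiLevelBlocks (cubes)
open Literature.MathematicalPhysics.QuantumFieldTheory.Balaban1983to89.B6Prop22DerivMultiLevelTorus (dT)
open Literature.MathematicalPhysics.QuantumFieldTheory.Balaban1983to89.B9Thm31CubeLocalFlat (GpCubeW thm31_cubeW_flat_first thm31_cubeW_flat_second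
  thm31_cubeW_flat_third)
open Literature.MathematicalPhysics.QuantumFieldTheory.Balaban1983to89.B9CubeLettersOpsL0 (oddMh cubeFamY)
open Literature.MathematicalPhysics.QuantumFieldTheory.Balaban1983to89.B9CubeLettersBondOpsL0 (BlkCubeY)
open Literature.MathematicalPhysics.QuantumFieldTheory.Balaban1983to89.B9Eq360DeltaPrimeACubeY (blkCubeY kQCubeY sQCubeY)
open Literature.MathematicalPhysics.QuantumFieldTheory.Balaban1983to89.B9CubeGeometryInputs (geoCK geoCK_len geoCK_eta geoCK_eta_pos geoCK_L geoCK_dist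
  geoCK_dist_axioms geoCK_len_pos geoCK_eta_le_len RM1 N1 exists_h261_geoCK hST_geoCK stencil_geoCK geoCK_site_nonempty)
open Literature.MathematicalPhysics.QuantumFieldTheory.Balaban1983to89.B9Cor35GpCubeInputsAtOne (GpW DpK GpK DpK_mul_GpK wK cfunK wK_nonneg
  card_block_mul_wK_le norm_kQCubeY_one_le norm_sQCubeY_one_le abs_cfunK_le hasMajorant_toB6_of_geomT h342_1_cube h342_2_cube_inl h342_3_cube_inr
  h342_2_cube_inr h342_3_cube_inl hasMajorant_transpose_dT_mul_GpW hasMajorant_GpW_mul_dT transfer_pow_of_scaleTransfer)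
open Literature.MathematicalPhysics.QuantumFieldTheory.Balaban1983to89.Node00 (SiteY CfgY SiteParY toKT shiftY)
open scoped Matrix

variable {d ℓ : ℕ} {hd : 1 ≤ d + 1} {hL : Odd (ℓ + 1) ∧ 1 < ℓ + 1} {b₀ b₁ : ℝ}

/-! ## §1  Theorem 3.1 (3.42)₁₋₃ at `U = 1` for `G′_□`, ALL FIVE ORIENTATIONS, ONE RATE, over `toB6 (geoCK i □)`, uniformly in the member and the cube -/

section Merged

/-- weakening a weighted exponential majorant in constant and rate. [cite: Balaban1984PropagatorsII, (2.54) p.233, bookkeeping] -/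
theorem hasMajorant_weaken (i : KIdx d ℓ hd hL b₀ b₁) (c : ↥(cubes (toKT i).D.toDomains)) (Rr : ℝ) (H : Prop) {X : Type} {blk : X → BlkCubeY i c}
    {T : Module.End ℝ (X → ℝ)} {C C' δ δ' : ℝ} (w : BlkCubeY i c → ℝ) (hw : ∀ a, 0 ≤ w a) (hC : C ≤ C') (hC' : 0 ≤ C') (hδ : δ' ≤ δ)
    (h : HasMajorant (g := toB6 (geoCK i c) Rr H) blk T (fun a a' => C * w a * Real.exp (-(δ * (geoCK i c).dist a a')))) :
    HasMajorant (g := toB6 (geoCK i c) Rr H) blk T (fun a a' => C' * w a * Real.exp (-(δ' * (geoCK i c).dist a a'))) := by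
  have hdnn := (geoCK_dist_axioms i c Rr H).1
  refine hasMajorant_mono (g := toB6 (geoCK i c) Rr H) _ h fun a a' => ?_
  calc C * w a * Real.exp (-(δ * (geoCK i c).dist a a')) ≤ C' * w a * Real.exp (-(δ * (geoCK i c).dist a a')) :=
        mul_le_mul_of_nonneg_right (mul_le_mul_of_nonneg_right hC (hw a)) (Real.exp_nonneg _)
    _ ≤ C' * w a * Real.exp (-(δ' * (geoCK i c).dist a a')) :=
        mul_le_mul_of_nonneg_left (B9FromB6.decay_mono hδ (hdnn a a')) (mul_nonneg hC' (hw a))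

/-- ★★★ **THEOREM 3.1 (3.42)₁₋₃ AT `U = 1` FOR THE CUBE LETTER `G′_□`, ALL BOND ORIENTATIONS, ONE RATE `δ₁` AND ONE CONSTANT `C₁` (functions of `d, L`
only), UNIFORMLY IN THE MEMBER AND THE COVER CUBE** — M5.1a's three printed orientations (`thm31_cubeW_flat_first/second/third`) read over FILE 5a's
`toB6 (geoCK i □)`, and the two unprinted ones by FILE 5b's one-step shift (its (2.61) and scale-transfer inputs supplied by FILE 5a), above member
thresholds `M₀ ≤ L·M_h`, `N₀ + 1 ≤ R·L·M_h`, `T₀ ≤ R·L·M_h − 1`.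
[cite: Balaban1985BackgroundPropagators, Thm 3.1 (3.42) p.397, Cor. 3.5 p.407, p.409 l.1–5, p.399 l.1–3; Balaban1984PropagatorsII, Prop. 2.2 (2.67) p.234, Lemma 2.1 p.234] -/
theorem thm31_cube_allOrientations (d ℓ : ℕ) (hℓ : 1 ≤ ℓ) :
    ∃ δ₁ C₁ M₀ T₀ : ℝ, ∃ N₀ : ℕ, 0 < δ₁ ∧ 0 < C₁ ∧
      ∀ {hd : 1 ≤ d + 1} {hL : Odd (ℓ + 1) ∧ 1 < ℓ + 1} {b₀ b₁ : ℝ} (i : KIdx d ℓ hd hL b₀ b₁) (c : ↥(cubes (toKT i).D.toDomains)) (Rr : ℝ) (H : Prop),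
        M₀ ≤ ((ℓ : ℝ) + 1) * (toKT i).Mh → N₀ + 1 ≤ (toKT i).R * ((ℓ + 1) * (toKT i).Mh) → T₀ ≤ RM1 i →
        HasMajorant (g := toB6 (geoCK i c) Rr H) (blkCubeY i c) (Matrix.toLin' (GpW i c))
            (fun y y' => C₁ * ((ℓ : ℝ) + 1) ^ (2 * y.1.1) * Real.exp (-(δ₁ * (geoCK i c).dist y y'))) ∧
        (∀ μ, HasMajorant (g := toB6 (geoCK i c) Rr H) (blkCubeY i c) (Matrix.toLin' (dT (toKT i).NB μ * GpW i c))
            (fun y y' => C₁ * ((ℓ : ℝ) + 1) ^ y.1.1 * Real.exp (-(δ₁ * (geoCK i c).dist y y')))) ∧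
        (∀ μ, HasMajorant (g := toB6 (geoCK i c) Rr H) (blkCubeY i c) (Matrix.toLin' (GpW i c * (dT (toKT i).NB μ)ᵀ))
            (fun y y' => C₁ * ((ℓ : ℝ) + 1) ^ y.1.1 * Real.exp (-(δ₁ * (geoCK i c).dist y y')))) ∧
        (∀ μ, HasMajorant (g := toB6 (geoCK i c) Rr H) (blkCubeY i c) (Matrix.toLin' ((dT (toKT i).NB μ)ᵀ * GpW i c))
            (fun y y' => C₁ * ((ℓ : ℝ) + 1) ^ y.1.1 * Real.exp (-(δ₁ * (geoCK i c).dist y y')))) ∧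
        (∀ μ, HasMajorant (g := toB6 (geoCK i c) Rr H) (blkCubeY i c) (Matrix.toLin' (GpW i c * dT (toKT i).NB μ))
            (fun y y' => C₁ * ((ℓ : ℝ) + 1) ^ y.1.1 * Real.exp (-(δ₁ * (geoCK i c).dist y y')))) := by
  obtain ⟨δa, Ca, Ma, Na, hδa, hCa, -, -, ha⟩ := thm31_cubeW_flat_first d ℓ hℓ
  obtain ⟨δb, Cb, Mb, Nb, hδb, hCb, -, -, hb⟩ := thm31_cubeW_flat_second d ℓ hℓ
  obtain ⟨δc, Cc, Mc, Nc, hδc, hCc, -, -, hc⟩ := thm31_cubeW_flat_third d ℓ hℓ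
  -- one base rate below the three printed ones
  set δ : ℝ := min δa (min δb δc) / 2 with hδdef
  have hδpos : 0 < δ := by rw [hδdef]; exact half_pos (lt_min hδa (lt_min hδb hδc))
  have hδa' : δ ≤ δa / 2 := by rw [hδdef]; linarith [min_le_left δa (min δb δc)]
  have hδb' : δ ≤ δb / 2 := by rw [hδdef]; linarith [min_le_right δa (min δb δc), min_le_left δb δc]
  have hδc' : δ ≤ δc / 2 := by rw [hδdef]; linarith [min_le_right δa (min δb δc), min_le_right δb δc]
  -- (2.61) for the cube sequence at `(δ, 1/2)` (forward-right) and at `((1 − 1/2)δ, 1/2)` (backward-left)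
  have hδh : 0 < (1 - 1 / 2) * δ := by linarith
  obtain ⟨dB₁, h261₁⟩ := exists_h261_geoCK d ℓ hδpos
  obtain ⟨dB₂, h261₂⟩ := exists_h261_geoCK d ℓ hδh
  -- constants
  set Λ : ℝ := ((ℓ : ℝ) + 1) ^ 4 with hΛdef
  have hΛ0 : 0 ≤ Λ := by positivity
  set Cbl : ℝ := Real.exp δ * Cb * Λ * B6.c1 dB₂ ((1 - 1 / 2) * δ) (1 / 2) ^ 2 with hCbl
  set Cfr : ℝ := Cc * B6.c1 dB₁ δ (1 / 2) * Real.exp ((1 - 1 / 2) * δ) with hCfr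
  have hCbl0 : 0 ≤ Cbl := by rw [hCbl]; exact mul_nonneg (mul_nonneg (mul_nonneg (Real.exp_nonneg _) hCb.le) hΛ0) (sq_nonneg _)
  have hCfr0 : 0 ≤ Cfr := by rw [hCfr]; exact mul_nonneg (mul_nonneg hCc.le (c1_nonneg _ _ _)) (Real.exp_nonneg _)
  set C₁ : ℝ := Ca + Cb + Cc + Cbl + Cfr with hC₁
  have hC₁pos : 0 < C₁ := by rw [hC₁]; linarith
  refine ⟨δ / 4, C₁, max Ma (max Mb Mc), 4 * Real.log ((ℓ : ℝ) + 1) / (9 / 5000 * δ),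
    max (max Na (max Nb Nc)) (max (N1 d ℓ (9 / 5000 * δ)) (N1 d ℓ (9 / 5000 * ((1 - 1 / 2) * δ)))), by linarith, hC₁pos, ?_⟩
  intro hd hL b₀ b₁ i c Rr H hM hN hT
  have h3 : 3 ≤ (toKT i).Mh := le_trans (by norm_num) i.hM8
  have hR := (toKT i).hR
  have hP4 := (toKT i).hP4
  -- unpack the thresholds
  have hMa : Ma ≤ ((ℓ : ℝ) + 1) * (toKT i).Mh := (le_max_left _ _).trans hM
  have hMb : Mb ≤ ((ℓ : ℝ) + 1) * (toKT i).Mh := ((le_max_left _ _).trans (le_max_right _ _)).trans hM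
  have hMc : Mc ≤ ((ℓ : ℝ) + 1) * (toKT i).Mh := ((le_max_right _ _).trans (le_max_right _ _)).trans hM
  have hNa : Na + 1 ≤ (toKT i).R * ((ℓ + 1) * (toKT i).Mh) :=
    le_trans (Nat.succ_le_succ ((le_max_left _ _).trans (le_max_left _ _))) hN
  have hNb : Nb + 1 ≤ (toKT i).R * ((ℓ + 1) * (toKT i).Mh) :=
    le_trans (Nat.succ_le_succ (((le_max_left _ _).trans (le_max_right _ _)).trans (le_max_left _ _))) hN
  have hNc : Nc + 1 ≤ (toKT i).R * ((ℓ + 1) * (toKT i).Mh) :=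
    le_trans (Nat.succ_le_succ (((le_max_right _ _).trans (le_max_right _ _)).trans (le_max_left _ _))) hN
  have hN1 : N1 d ℓ (9 / 5000 * δ) + 1 ≤ (toKT i).R * ((ℓ + 1) * (toKT i).Mh) :=
    le_trans (Nat.succ_le_succ ((le_max_left _ _).trans (le_max_right _ _))) hN
  have hN2 : N1 d ℓ (9 / 5000 * ((1 - 1 / 2) * δ)) + 1 ≤ (toKT i).R * ((ℓ + 1) * (toKT i).Mh) :=
    le_trans (Nat.succ_le_succ ((le_max_right _ _).trans (le_max_right _ _))) hN
  -- the three printed orientations, read over `toB6 (geoCK i c)` and weakened to `(C₁, δ/4)` / kept at `δ` for the shift inputs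
  have hdnn := (geoCK_dist_axioms i c Rr H).1
  have htri := (geoCK_dist_axioms i c Rr H).2.1
  have hpow1 : ∀ a : BlkCubeY i c, 0 ≤ ((ℓ : ℝ) + 1) ^ a.1.1 := fun a => by positivity
  have hpow2 : ∀ a : BlkCubeY i c, 0 ≤ ((ℓ : ℝ) + 1) ^ (2 * a.1.1) := fun a => by positivity
  have hA0 := hasMajorant_toB6_of_geomT i c Rr H (ha (toKT i).D c hL.1 (oddMh i) (toKT i).hMh (toKT i).hP h3 hMa hR hNa hP4)
  have hB0 := fun μ => hasMajorant_toB6_of_geomT i c Rr H (hb (toKT i).D c hL.1 (oddMh i) (toKT i).hMh (toKT i).hP h3 hMb hR hNb hP4 μ)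
  have hC0 := fun μ => hasMajorant_toB6_of_geomT i c Rr H (hc (toKT i).D c hL.1 (oddMh i) (toKT i).hMh (toKT i).hP h3 hMc hR hNc hP4 μ)
  have hBδ : ∀ μ, HasMajorant (g := toB6 (geoCK i c) Rr H) (blkCubeY i c) (Matrix.toLin' (dT (toKT i).NB μ * GpW i c))
      (fun y y' => Cb * ((ℓ : ℝ) + 1) ^ y.1.1 * Real.exp (-(δ * (geoCK i c).dist y y'))) :=
    fun μ => hasMajorant_weaken i c Rr H _ hpow1 le_rfl hCb.le hδb' (hB0 μ)
  have hCδ : ∀ μ, HasMajorant (g := toB6 (geoCK i c) Rr H) (blkCubeY i c) (Matrix.toLin' (GpW i c * (dT (toKT i).NB μ)ᵀ))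
      (fun y y' => Cc * ((ℓ : ℝ) + 1) ^ y.1.1 * Real.exp (-(δ * (geoCK i c).dist y y'))) :=
    fun μ => hasMajorant_weaken i c Rr H _ hpow1 le_rfl hCc.le hδc' (hC0 μ)
  -- the scale transfer of `Lⁿ` at `(δ, 1/2)` and (2.61) at the two pairs
  have hPΛ := transfer_pow_of_scaleTransfer i c ((hST_geoCK i c hδpos hT (1 / 2) (by norm_num)).1)
  have h261fr : Ineq261 dB₁ (toB6 (geoCK i c) Rr H) δ (1 / 2) := h261₁ i c Rr H hN1 (1 / 2) (by norm_num) (by norm_num)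
  have h261bl : Ineq261 dB₂ (toB6 (geoCK i c) Rr H) ((1 - 1 / 2) * δ) (1 / 2) := h261₂ i c Rr H hN2 (1 / 2) (by norm_num) (by norm_num)
  -- the two unprinted orientations (FILE 5b §5)
  have hBL : ∀ μ, HasMajorant (g := toB6 (geoCK i c) Rr H) (blkCubeY i c) (Matrix.toLin' ((dT (toKT i).NB μ)ᵀ * GpW i c))
      (fun y y' => Cbl * ((ℓ : ℝ) + 1) ^ y.1.1 * Real.exp (-((1 - 1 / 2) * ((1 - 1 / 2) * δ) * (geoCK i c).dist y y'))) :=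
    fun μ => hasMajorant_transpose_dT_mul_GpW i c Rr H dB₂ hCb.le hδpos.le hΛ0 (by linarith) hδh.le (by norm_num) htri hPΛ h261bl μ (hBδ μ)
  have hFR : ∀ μ, HasMajorant (g := toB6 (geoCK i c) Rr H) (blkCubeY i c) (Matrix.toLin' (GpW i c * dT (toKT i).NB μ))
      (fun y y' => Cfr * ((ℓ : ℝ) + 1) ^ y.1.1 * Real.exp (-((1 - 1 / 2) * δ * (geoCK i c).dist y y'))) := by
    intro μ
    refine hasMajorant_mono (g := toB6 (geoCK i c) Rr H) _ (hasMajorant_GpW_mul_dT i c Rr H dB₁ hCc.le hδh.le htri h261fr μ (hCδ μ)) fun a a' => ?_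
    rw [hCfr]
    exact le_of_eq (by ring)
  -- collect at `(C₁, δ/4)`
  have hle_a : Ca ≤ C₁ := by rw [hC₁]; linarith
  have hle_b : Cb ≤ C₁ := by rw [hC₁]; linarith
  have hle_c : Cc ≤ C₁ := by rw [hC₁]; linarith
  have hle_bl : Cbl ≤ C₁ := by rw [hC₁]; linarith
  have hle_fr : Cfr ≤ C₁ := by rw [hC₁]; linarith
  refine ⟨hasMajorant_weaken i c Rr H _ hpow2 hle_a hC₁pos.le (by linarith) hA0,
    fun μ => hasMajorant_weaken i c Rr H _ hpow1 hle_b hC₁pos.le (by linarith) (hBδ μ),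
    fun μ => hasMajorant_weaken i c Rr H _ hpow1 hle_c hC₁pos.le (by linarith) (hCδ μ),
    fun μ => hasMajorant_weaken i c Rr H _ hpow1 hle_bl hC₁pos.le (by linarith) (hBL μ),
    fun μ => hasMajorant_weaken i c Rr H _ hpow1 hle_fr hC₁pos.le (by linarith) (hFR μ)⟩

end Merged

/-! ## §2  ★★★ COROLLARY 3.5 FOR `G′_□`: `thm34_Gp_uniform` APPLIED AT `U := 1`, `g := geoCK i □`, the FILE 1 letters and the FILE 5b binders -/

section Apply

variable {𝔸 : Type} [NormedRing 𝔸] [NormedAlgebra ℂ 𝔸] [CompleteSpace 𝔸]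
variable {ι : Type} [Fintype ι] [DecidableEq ι] (b : Module.Basis ι ℝ 𝔸)

/-- the reverse bridge: block majorants over `toB6 (geoCK i □)` are block majorants over N03's `geomT (cubeFamY i □)`.
[cite: Balaban1984PropagatorsII, (2.51) p.232, bookkeeping] -/
theorem hasMajorant_geomT_of_toB6 (i : KIdx d ℓ hd hL b₀ b₁) (c : ↥(cubes (toKT i).D.toDomains)) {X : Type} {blk : X → BlkCubeY i c}
    {T : Module.End ℝ (X → ℝ)} {K : BlkCubeY i c → BlkCubeY i c → ℝ} (Rr : ℝ) (H : Prop)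
    (h : HasMajorant (g := toB6 (geoCK i c) Rr H) blk T K) : HasMajorant (g := B6Geom246MultiLevelTorusL0.geomT (cubeFamY i c)) blk T K :=
  fun y' μ B hμ x => h y' μ B ⟨hμ.nonneg, hμ.bound, hμ.off⟩ x

/-- ★★★ **COROLLARY 3.5 p. 407 FOR THE CUBE LETTER `G′_□` — THEOREM 3.4's CONCLUSION AT `U = 1` OVER THE CUBE SEQUENCE, UNIFORMLY IN THE MEMBER AND THE
COVER CUBE**: there are `δ₀, B_G > 0`, thresholds `M₀, T₀, N₀` and Theorem 3.4's `a₁ > 0`, `B ≥ 0` — functions of `d, L`, the basis datum `M₂` and the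
(3.59) size `C_q` only (p. 399 l. 1–3) — such that for every member above the thresholds, every cover cube `□`, every transporter letter with
`par 1 = 1`, every `0 ≤ α₁ ≤ a₁` and every vector potential `A` with the blockwise (3.37) bounds over the cube blocks and (3.59) kernels `kF, sF`:
`G′_□(U′·1) := gPrimeExtEnd Gp (conj b V′(A)·Gp)` (with `Gp = conj b(η²G′_□(1))`, `Δp = conj b(η⁻²Δ′_{a,□}(1))`, `V′(A)` the concrete (3.60) letter on
FILE 1's kernels) is the two-sided inverse of `Δp − conj b V′(A)`, and every left entry `X·Gp ≺ B_G·P·e^{−δ₀d}` ∕ right entry `Gp·Y ≺ B_G·Lⁿη·e^{−δ₀d}`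
transfers to it at `(B, 9δ₀/10)` — `B9Thm34SectBUniformR1.thm34_Gp_uniform` with every `A`-independent binder DISCHARGED (FILES 5a, 5b, §1).
[cite: Balaban1985BackgroundPropagators, Cor. 3.5 p.407, Thm 3.4 p.400, p.399 l.1–3, p.409 l.1–5, (3.60)–(3.65) p.402, Thm 3.1 (3.42) p.397; Balaban1984PropagatorsII, Lemma 2.1 p.234, Prop. 2.2 p.234] -/
theorem cor35_Gp_cube (d ℓ : ℕ) (hℓ : 1 ≤ ℓ) (Cq M₂ : ℝ) (hCq : 0 ≤ Cq) (hM₂ : 0 ≤ M₂) (hrepr : ∀ (v : 𝔸) (j : ι), |b.repr v j| ≤ M₂ * ‖v‖)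
    (h1 : ‖(1 : 𝔸)‖ ≤ 1) :
    ∃ δ₀ BG M₀ T₀ : ℝ, ∃ N₀ : ℕ, 0 < δ₀ ∧ 0 < BG ∧ ∃ a₁ : ℝ, 0 < a₁ ∧ ∃ B : ℝ, 0 ≤ B ∧
    ∀ {hd : 1 ≤ d + 1} {hL : Odd (ℓ + 1) ∧ 1 < ℓ + 1} {b₀ b₁ : ℝ} (i : KIdx d ℓ hd hL b₀ b₁) (c : ↥(cubes (toKT i).D.toDomains)) (Rr : ℝ) (H : Prop)
      (par : SiteParY 𝔸 i), (∀ z w, par (fun _ _ => 1) z w = 1) →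
      M₀ ≤ ((ℓ : ℝ) + 1) * (toKT i).Mh → N₀ + 1 ≤ (toKT i).R * ((ℓ + 1) * (toKT i).Mh) → T₀ ≤ RM1 i →
    ∀ (α₁ : ℝ), 0 ≤ α₁ → α₁ ≤ a₁ →
    ∀ (A : Fin (d + 1) → SiteY i → 𝔸) (kF : BlkCubeY i c → SiteY i → 𝔸 →L[ℝ] 𝔸) (sF : SiteY i → 𝔸 →L[ℝ] 𝔸),
      (∀ y x, blkCubeY i c x = y → ‖kF y x‖ ≤ Cq * α₁ * wK i c y) → (∀ x, ‖sF x‖ ≤ Cq * α₁) →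
      (∀ ν k x, ‖(((geoCK i c).eta : ℂ)⁻¹) • covDstar (shiftY i) (fun _ _ => (1 : 𝔸ˣ)) ν (A k) x‖ ≤ α₁ * ((geoCK i c).len (blkCubeY i c x) ^ 2)⁻¹) →
      (∀ μ ν x, ‖(((geoCK i c).eta : ℂ)⁻¹) • covD (shiftY i) (fun _ _ => (1 : 𝔸ˣ)) μ (A ν) x‖ ≤ α₁ * ((geoCK i c).len (blkCubeY i c x) ^ 2)⁻¹) →
      (∀ μ x, ‖(((geoCK i c).eta : ℂ)⁻¹) • covDstar (shiftY i) (fun _ _ => (1 : 𝔸ˣ)) μ (tauB (shiftY i) (fun _ _ => (1 : 𝔸ˣ)) μ (A μ)) x‖ ≤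
        α₁ * ((geoCK i c).len (blkCubeY i c x) ^ 2)⁻¹) →
      (∀ k x, ‖A k x‖ ≤ α₁ * ((geoCK i c).len (blkCubeY i c x))⁻¹) →
      (∀ ν k x, ‖tauB (shiftY i) (fun _ _ => (1 : 𝔸ˣ)) ν (A k) x‖ ≤ α₁ * ((geoCK i c).len (blkCubeY i c x))⁻¹) →
      (DpK b i c par - conj b (vPrimeConc (shiftY i) (fun _ _ => (1 : 𝔸ˣ)) (geoCK i c).eta A (blkCubeY i c) (kQCubeY i c par (fun _ _ => 1)) kF
          (sQCubeY i c par (fun _ _ => 1)) sF (cfunK i c))) *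
        (gPrimeExtEnd (GpK b i c par) (conj b (vPrimeConc (shiftY i) (fun _ _ => (1 : 𝔸ˣ)) (geoCK i c).eta A (blkCubeY i c)
          (kQCubeY i c par (fun _ _ => 1)) kF (sQCubeY i c par (fun _ _ => 1)) sF (cfunK i c)) * GpK b i c par)) = 1 ∧
      (gPrimeExtEnd (GpK b i c par) (conj b (vPrimeConc (shiftY i) (fun _ _ => (1 : 𝔸ˣ)) (geoCK i c).eta A (blkCubeY i c)
          (kQCubeY i c par (fun _ _ => 1)) kF (sQCubeY i c par (fun _ _ => 1)) sF (cfunK i c)) * GpK b i c par)) *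
        (DpK b i c par - conj b (vPrimeConc (shiftY i) (fun _ _ => (1 : 𝔸ˣ)) (geoCK i c).eta A (blkCubeY i c) (kQCubeY i c par (fun _ _ => 1)) kF
          (sQCubeY i c par (fun _ _ => 1)) sF (cfunK i c))) = 1 ∧
      (∀ (X : Module.End ℝ (SiteY i × ι → ℝ)) (P : BlkCubeY i c → ℝ), (∀ y, 0 ≤ P y) →
        HasMajorant (g := toB6 (geoCK i c) Rr H) (fun p : SiteY i × ι => blkCubeY i c p.1) (X * GpK b i c par)
          (fun a a' => BG * P a * Real.exp (-(δ₀ * (geoCK i c).dist a a'))) →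
        HasMajorant (g := toB6 (geoCK i c) Rr H) (fun p : SiteY i × ι => blkCubeY i c p.1)
          (X * (gPrimeExtEnd (GpK b i c par) (conj b (vPrimeConc (shiftY i) (fun _ _ => (1 : 𝔸ˣ)) (geoCK i c).eta A (blkCubeY i c)
            (kQCubeY i c par (fun _ _ => 1)) kF (sQCubeY i c par (fun _ _ => 1)) sF (cfunK i c)) * GpK b i c par)))
          (fun a a' => B * P a * Real.exp (-(9 / 10 * δ₀ * (geoCK i c).dist a a')))) ∧
      (∀ Y : Module.End ℝ (SiteY i × ι → ℝ),
        HasMajorant (g := toB6 (geoCK i c) Rr H) (fun p : SiteY i × ι => blkCubeY i c p.1) (GpK b i c par * Y)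
          (fun a a' => BG * (geoCK i c).len a * Real.exp (-(δ₀ * (geoCK i c).dist a a'))) →
        HasMajorant (g := toB6 (geoCK i c) Rr H) (fun p : SiteY i × ι => blkCubeY i c p.1)
          ((gPrimeExtEnd (GpK b i c par) (conj b (vPrimeConc (shiftY i) (fun _ _ => (1 : 𝔸ˣ)) (geoCK i c).eta A (blkCubeY i c)
            (kQCubeY i c par (fun _ _ => 1)) kF (sQCubeY i c par (fun _ _ => 1)) sF (cfunK i c)) * GpK b i c par)) * Y)
          (fun a a' => B * (geoCK i c).len a * Real.exp (-(9 / 10 * δ₀ * (geoCK i c).dist a a')))) := by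
  classical
  -- §1: Theorem 3.1 for `G′_□(1)`, all orientations, one rate `δ₁`, one constant `C₁`
  obtain ⟨δ₁, C₁, M₀, T₀, N₀, hδ₁, hC₁, h31⟩ := thm31_cube_allOrientations d ℓ hℓ
  -- FILE 5a: ONE (2.61) exponent `dB` at the rate `δ₁`
  obtain ⟨dB, h261⟩ := exists_h261_geoCK d ℓ hδ₁
  -- Sect. B's engine, lattice-free constants
  have hΛf : ∀ α : ℝ, 0 < α → (1 : ℝ) ≤ ((ℓ : ℝ) + 1) ^ 4 := fun α _ =>
    one_le_pow₀ (by linarith [(Nat.cast_nonneg ℓ : (0 : ℝ) ≤ ℓ)])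
  obtain ⟨a₁, ha₁, B, hB, H34⟩ := thm34_Gp_uniform (κ := Fin (d + 1)) b dB δ₁ C₁ Cq 1 1 M₂ (fun _ => ((ℓ : ℝ) + 1) ^ 4) hC₁ hCq zero_le_one hM₂ hδ₁
    hΛf hrepr
  refine ⟨δ₁, C₁, M₀, max T₀ (4 * Real.log ((ℓ : ℝ) + 1) / (9 / 5000 * δ₁)), max N₀ (N1 d ℓ (9 / 5000 * δ₁)), hδ₁, hC₁, a₁, ha₁, B, hB, ?_⟩
  intro hd hL b₀ b₁ i c Rr H par hpar hM hN hT α₁ hα₁0 hα₁1 A kF sF hkF hsF h337B h337F h337Bτ hA hAτB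
  haveI : Nonempty (geoCK i c).Site := geoCK_site_nonempty i c
  have hN₀ : N₀ + 1 ≤ (toKT i).R * ((ℓ + 1) * (toKT i).Mh) := le_trans (Nat.succ_le_succ (le_max_left _ _)) hN
  have hN1 : N1 d ℓ (9 / 5000 * δ₁) + 1 ≤ (toKT i).R * ((ℓ + 1) * (toKT i).Mh) := le_trans (Nat.succ_le_succ (le_max_right _ _)) hN
  have hT₀ : T₀ ≤ RM1 i := (le_max_left _ _).trans hT
  have hT1 : 4 * Real.log ((ℓ : ℝ) + 1) / (9 / 5000 * δ₁) ≤ RM1 i := (le_max_right _ _).trans hT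
  obtain ⟨hdnn, htri, hrefl, hsym⟩ := geoCK_dist_axioms i c Rr H
  obtain ⟨hd₀B, hd₀F, hd₀0⟩ := stencil_geoCK i c
  obtain ⟨e1, e2, e3, e2', e3'⟩ := h31 i c Rr H hM hN₀ hT₀
  -- Theorem 3.1 in conj-`b` form (FILE 5b)
  have g342_1 := h342_1_cube b i c par hpar Rr H (hasMajorant_geomT_of_toB6 i c Rr H e1)
  have g342_2 : ∀ k : Fin (d + 1) ⊕ Fin (d + 1), HasMajorant (g := toB6 (geoCK i c) Rr H) (fun p : SiteY i × ι => blkCubeY i c p.1)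
      (conj b (diffLetter (shiftY i) (fun _ _ => (1 : 𝔸ˣ)) ((((geoCK i c).eta : ℂ))⁻¹) k) * GpK b i c par)
      (fun a a' => C₁ * (geoCK i c).len a * Real.exp (-(δ₁ * (geoCK i c).dist a a'))) := by
    rintro (μ | μ)
    · exact h342_2_cube_inl b i c par hpar Rr H μ (hasMajorant_geomT_of_toB6 i c Rr H (e2 μ))
    · exact h342_2_cube_inr b i c par hpar Rr H μ (e2' μ)
  have g342_3 : ∀ k : Fin (d + 1) ⊕ Fin (d + 1), HasMajorant (g := toB6 (geoCK i c) Rr H) (fun p : SiteY i × ι => blkCubeY i c p.1)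
      (GpK b i c par * conj b (diffLetter (shiftY i) (fun _ _ => (1 : 𝔸ˣ)) ((((geoCK i c).eta : ℂ))⁻¹) k))
      (fun a a' => C₁ * (geoCK i c).len a * Real.exp (-(δ₁ * (geoCK i c).dist a a'))) := by
    rintro (μ | μ)
    · exact h342_3_cube_inl b i c par hpar Rr H μ (e3' μ)
    · exact h342_3_cube_inr b i c par hpar Rr H μ (hasMajorant_geomT_of_toB6 i c Rr H (e3 μ))
  obtain ⟨hlaw1, hlaw2⟩ := DpK_mul_GpK b i c par hpar
  exact H34 (shiftY i) (fun _ _ => (1 : 𝔸ˣ)) (g := geoCK i c) (Rr := Rr) (H := H) (blkCubeY i c) (kQCubeY i c par (fun _ _ => 1))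
    (sQCubeY i c par (fun _ _ => 1)) (cfunK i c) (wK i c) hdnn htri hrefl hsym (geoCK_len_pos i c) (geoCK_eta_le_len i c) (geoCK_eta_pos i c)
    (fun α hα hα1 => h261 i c Rr H hN1 α hα hα1.le) (hST_geoCK i c hδ₁ hT1)
    (fun _ _ => ⟨h1, by rw [inv_one, Units.val_one]; exact h1⟩) hd₀B hd₀F hd₀0 (wK_nonneg i c) (card_block_mul_wK_le i c)
    (fun y x hx => by rw [← hx]; exact norm_kQCubeY_one_le i c par h1 hpar _ x) (norm_sQCubeY_one_le i c par h1 hpar) (abs_cfunK_le i c)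
    hlaw1 hlaw2 g342_1 g342_2 g342_3 α₁ hα₁0 hα₁1 A kF sF hkF hsF h337B h337F h337Bτ hA hAτB

end Apply

end Literature.MathematicalPhysics.QuantumFieldTheory.Balaban1983to89.B9Cor35GpAtCubeLetters

end
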